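import Mathlib
import Literature.NumberTheory.LFunctions.Zhang2022.Section18SjNormMajorant
import Literature.NumberTheory.LFunctions.Zhang2022.Section8ArithmeticIdentity
import HarnessLib

/-!
# Zhang (2022) §8 p. 47, the "simple approximation" `Z22:§8.u044`: the arithmetic weights of
# `S_j(𝐚₁₁,𝐚₂₁)` — the pointwise majorant over the factorisations `n = dr`

Topic `Literature/NumberTheory/LFunctions/Zhang2022` (Landau–Siegel audit tree; verdict-neutral).
Y. Zhang, *Discrete mean estimates and the Landau–Siegel zero*, arXiv:2211.02515v1 (2022)
[Zhang2022LandauSiegel] — **an unrefereed manuscript under adjudication**; D-0069 campaign, cell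
`siegel-zhang`, DISCHARGE lane, node `Z22:§8.u044` ("Gathering these results together we conclude, by
simple approximation, …", tex L2436, PDF p. 47; GAP row G-d20-1). Theorem-only, unconditional,
from the definitions of §7 (`λ₀ⱼ`, `S_j`) and Lemma 8.3 (`Π(d,r)`) only. These are the two
bookkeeping inputs of the reduction `DedStep8u044 ⇐ XiZeroTailMean` (file
`Section8FrontEnd44Reduction`): once the inner sums `M_k, N_k` of
`S_j = Σ_n Σ_{dr=n} w_j(d,r)(M₁+ι₂M₂)(N₁+ῑ₂N₂) + …` (`Section8FrontEnd44Exact.Sj_a11_a21_eq`) are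
replaced by their main terms with errors `δ(d,r)`, the total error is `Σ_n Σ_{dr=n} |w_j(d,r)|δ(d,r)`,
and one needs (i) a majorant for the weight aggregated over the factorisations of `n`, and (ii) its
logarithmically weighted moments over MULTIPLICATIVE INTERVALS `[Y, Z)` (the tail ranges
`[P_k/T, P_k)` have `log(Z/Y) = log T = 𝓛^{1.1}`, against `log P_k ≍ 𝓛⁹` for the full range).

* `sum_sqfree_inv_totient` — `Σ_{r∣n, r squarefree} 1/φ(r) = n/φ(n)`;
* `norm_PiW_le` — `|Π(d,r)| ≤ (dr/φ(dr))²` for any Dirichlet character (`|χ(q)| ≤ 1`);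
* `weight_antidiagonal_le` — for `n ≥ 1`,
  `Σ_{dr=n} |μ(r)|·‖λ₀ⱼ(n)‖(1 + ‖Π(d,r)‖)/(nφ(r)) ≤ 2n⁻¹∏_{q∣n}(1 + 106/q)`
  (with the tree's `Sec18SjNorm.norm_lamZero_le`: `‖λ₀ⱼ(n)‖ ≤ (φ(n)/n)∏_{q∣n}(1+25/q)`, and
  `(n/φ(n))² ≤ ∏_{q∣n}(1 + 6/q)`);
* (companion file `Section8FrontEnd44Moments`: the increment moment bound
  `Σ_{⌈Y⌉≤n<⌈Z⌉} n⁻¹∏_{q∣n}(1 + c/q)·g(n) ≤ eᶜ·G·(1 + log(Z/Y))`).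

WHAT THIS FILE IS NOT: any claim of the manuscript; nothing here bears on its Theorems 1–2 or on
Landau–Siegel zeros. No definition, no new fact.

## References

* Y. Zhang, arXiv:2211.02515v1 (2022), §8 p. 47 (tex L2436), §7 p. 33 (`λ`, `S_j`), Lemma 8.3
  p. 46 (`Π(d,r)`). [cite: Zhang2022LandauSiegel, §8 p.47]
-/

noncomputable section

open Complex Real Finset

namespace Literature.NumberTheory.LFunctions.Zhang2022.Section8FrontEnd44Weights

open Literature.NumberTheory.LFunctions.Zhang2022.Skeleton

/-! ## `Σ_{r ∣ n squarefree} 1/φ(r) = n/φ(n)` -/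

/-- Euler's product as a quotient: `n/φ(n) = ∏_{q∣n}(1 − 1/q)⁻¹`, and the product is positive. [folklore] -/
private theorem prod_one_sub_inv_pos (n : ℕ) : 0 < ∏ q ∈ n.primeFactors, (1 - 1 / (q : ℝ)) := by
  apply Finset.prod_pos
  intro q hq
  have hq2 : (2 : ℝ) ≤ q := by exact_mod_cast (Nat.prime_of_mem_primeFactors hq).two_le
  have : 1 / (q : ℝ) ≤ 1 / 2 := by
    rw [div_le_div_iff₀ (by linarith) (by norm_num)]; linarith
  linarith

/-- **`Σ_{r∣n, r squarefree} 1/φ(r) = n/φ(n)`** for `n ≥ 1` (both sides equal `∏_{q∣n} q/(q−1)`;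
here via the tree's binomial expansion `sum_squarefree_divisors_prod_sdiff` at `h(q) = 1 − 1/q`).
[cite: Zhang2022LandauSiegel, §8 p.47 (the weight `|μ(r)|/(drφ(r))` of `S_j`)] -/
theorem sum_sqfree_inv_totient {n : ℕ} (hn : n ≠ 0) :
    ∑ r ∈ n.divisors with Squarefree r, 1 / (Nat.totient r : ℝ) = (n : ℝ) / Nat.totient n := by
  have key := sum_squarefree_divisors_prod_sdiff (fun q => 1 - 1 / (q : ℝ)) hn
  have hR : ∏ q ∈ n.primeFactors, (1 / (q : ℝ) + (1 - 1 / q)) = 1 :=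
    Finset.prod_eq_one (fun q _ => by ring)
  rw [hR] at key
  have hφn : (Nat.totient n : ℝ) = n * ∏ q ∈ n.primeFactors, (1 - 1 / (q : ℝ)) :=
    totient_eq_mul_prod_real n
  have hnR : (0 : ℝ) < n := by exact_mod_cast Nat.pos_of_ne_zero hn
  have hPn := prod_one_sub_inv_pos n
  have hterm : ∀ r ∈ n.divisors.filter Squarefree,
      (1 / (r : ℝ)) * ∏ q ∈ n.primeFactors \ r.primeFactors, (1 - 1 / (q : ℝ)) =
        ((Nat.totient n : ℝ) / n) * (1 / Nat.totient r) := by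
    intro r hr
    rw [Finset.mem_filter, Nat.mem_divisors] at hr
    have hrn : r ∣ n := hr.1.1
    have hr0 : r ≠ 0 := fun h => hn (by rw [h] at hrn; exact zero_dvd_iff.mp hrn)
    have hrR : (0 : ℝ) < r := by exact_mod_cast Nat.pos_of_ne_zero hr0
    have hsub : r.primeFactors ⊆ n.primeFactors := Nat.primeFactors_mono hrn hn
    have hφr : (Nat.totient r : ℝ) = r * ∏ q ∈ r.primeFactors, (1 - 1 / (q : ℝ)) :=
      totient_eq_mul_prod_real r
    have hPr := prod_one_sub_inv_pos r
    have hsplit : ∏ q ∈ n.primeFactors, (1 - 1 / (q : ℝ)) =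
        (∏ q ∈ n.primeFactors \ r.primeFactors, (1 - 1 / (q : ℝ))) *
          ∏ q ∈ r.primeFactors, (1 - 1 / (q : ℝ)) := (Finset.prod_sdiff hsub).symm
    rw [hφn, hφr, hsplit]
    field_simp
  rw [Finset.sum_congr rfl hterm, ← Finset.mul_sum] at key
  have hφ0 : (0 : ℝ) < Nat.totient n := by
    exact_mod_cast Nat.totient_pos.mpr (Nat.pos_of_ne_zero hn)
  have h3 : ((Nat.totient n : ℝ) / n)⁻¹ = ∑ r ∈ n.divisors with Squarefree r, 1 / (Nat.totient r : ℝ) :=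
    inv_eq_of_mul_eq_one_right key
  rw [← h3, inv_div]

/-! ## `|Π(d,r)| ≤ (dr/φ(dr))²` -/

/-- For `q ≥ 2`: `(1 − 1/q)⁻¹ ≥ 1`. [folklore] -/
private theorem one_le_inv_one_sub {q : ℕ} (hq : 2 ≤ q) : (1 : ℝ) ≤ (1 - 1 / (q : ℝ))⁻¹ := by
  have hq2 : (2 : ℝ) ≤ q := by exact_mod_cast hq
  have h1 : 0 < 1 - 1 / (q : ℝ) := by
    have : 1 / (q : ℝ) ≤ 1 / 2 := by rw [div_le_div_iff₀ (by linarith) (by norm_num)]; linarith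
    linarith
  rw [one_le_inv₀ h1]
  have : 0 ≤ 1 / (q : ℝ) := by positivity
  linarith

/-- `1 ≤ ∏_{q∈s}(1 − 1/q)⁻¹` for a set `s` of integers `≥ 2`. [folklore] -/
private theorem one_le_prod_inv_one_sub {s : Finset ℕ} (hs : ∀ q ∈ s, 2 ≤ q) :
    (1 : ℝ) ≤ ∏ q ∈ s, (1 - 1 / (q : ℝ))⁻¹ := by
  calc (1 : ℝ) = ∏ q ∈ s, (1 : ℝ) := Finset.prod_const_one.symm
    _ ≤ ∏ q ∈ s, (1 - 1 / (q : ℝ))⁻¹ :=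
        Finset.prod_le_prod (fun _ _ => zero_le_one) fun q hq => one_le_inv_one_sub (hs q hq)

/-- Monotonicity in the index set: `∏_{q∈s}(1 − 1/q)⁻¹ ≤ ∏_{q∈t}(1 − 1/q)⁻¹` for `s ⊆ t`, `t` a set of
integers `≥ 2`. [folklore] -/
private theorem prod_inv_one_sub_mono {s t : Finset ℕ} (h : s ⊆ t) (ht : ∀ q ∈ t, 2 ≤ q) :
    ∏ q ∈ s, (1 - 1 / (q : ℝ))⁻¹ ≤ ∏ q ∈ t, (1 - 1 / (q : ℝ))⁻¹ := by
  rw [← Finset.prod_sdiff h]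
  refine le_mul_of_one_le_left ?_ (one_le_prod_inv_one_sub fun q hq => ht q (Finset.mem_sdiff.mp hq).1)
  exact Finset.prod_nonneg fun q hq => le_trans zero_le_one (one_le_inv_one_sub (ht q (h hq)))

/-- **`|Π(d,r)| ≤ (n/φ(n))²`, `n = dr ≥ 1`** (Lemma 8.3's local factor; any Dirichlet character, since
`|χ(q)| ≤ 1` gives `|1 − χ(q)q⁻¹| ≥ 1 − q⁻¹` and `|1 − q⁻¹ − χ(q)q⁻¹| ≤ 1`, and
`∏_{q∣n}(1 − q⁻¹)⁻¹ = n/φ(n)`). [cite: Zhang2022LandauSiegel, §8 Lemma 8.3 p.46] -/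
theorem norm_PiW_le {D : ℕ} [NeZero D] (χ : DirichletCharacter ℂ D) {d r : ℕ} (hd : 1 ≤ d)
    (hr : 1 ≤ r) :
    ‖PiW χ d r‖ ≤ (((d * r : ℕ) : ℝ) / Nat.totient (d * r)) ^ 2 := by
  have hn0 : d * r ≠ 0 := Nat.mul_ne_zero (by omega) (by omega)
  have hnR : (0 : ℝ) < ((d * r : ℕ) : ℝ) := by exact_mod_cast Nat.pos_of_ne_zero hn0
  set E : ℝ := ∏ q ∈ (d * r).primeFactors, (1 - 1 / (q : ℝ))⁻¹ with hE
  have hEq : ((d * r : ℕ) : ℝ) / Nat.totient (d * r) = E := by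
    rw [totient_eq_mul_prod_real (d * r), hE, Finset.prod_inv_distrib]
    field_simp
  have hE1 : 1 ≤ E := by
    rw [hE]
    exact one_le_prod_inv_one_sub fun q hq => (Nat.prime_of_mem_primeFactors hq).two_le
  rw [hEq, PiW, norm_mul, sq]
  apply mul_le_mul _ _ (norm_nonneg _) (le_trans zero_le_one hE1)
  · -- first factor
    rw [norm_prod, hE]
    apply Finset.prod_le_prod (fun q _ => norm_nonneg _)
    intro q hq
    have hqp := Nat.prime_of_mem_primeFactors hq
    have hq2 : (2 : ℝ) ≤ q := by exact_mod_cast hqp.two_le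
    have hqpos : (0 : ℝ) < q := by linarith
    have hlow : 1 - 1 / (q : ℝ) ≤ ‖1 - χ (q : ZMod D) * (q : ℂ)⁻¹‖ := by
      have h1 : ‖χ (q : ZMod D) * (q : ℂ)⁻¹‖ ≤ 1 / (q : ℝ) := by
        rw [norm_mul, norm_inv, Complex.norm_natCast, one_div]
        exact mul_le_of_le_one_left (by positivity) (DirichletCharacter.norm_le_one χ _)
      have h2 := norm_sub_norm_le (1 : ℂ) (χ (q : ZMod D) * (q : ℂ)⁻¹)
      rw [norm_one] at h2
      linarith
    have hpos : 0 < 1 - 1 / (q : ℝ) := by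
      have : 1 / (q : ℝ) ≤ 1 / 2 := by rw [div_le_div_iff₀ (by linarith) (by norm_num)]; linarith
      linarith
    rw [norm_inv]
    exact inv_anti₀ hpos hlow
  · -- second factor
    rw [norm_prod]
    calc ∏ q ∈ d.primeFactors.filter (fun q => Nat.Coprime q r),
          ‖(1 - (q : ℂ)⁻¹ - χ (q : ZMod D) * (q : ℂ)⁻¹) / (1 - (q : ℂ)⁻¹)‖
        ≤ ∏ q ∈ d.primeFactors.filter (fun q => Nat.Coprime q r), (1 - 1 / (q : ℝ))⁻¹ := by
          apply Finset.prod_le_prod (fun q _ => norm_nonneg _)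
          intro q hq
          have hqp := Nat.prime_of_mem_primeFactors (Finset.mem_filter.mp hq).1
          have hq2 : (2 : ℝ) ≤ q := by exact_mod_cast hqp.two_le
          have hqpos : (0 : ℝ) < q := by linarith
          have hpos : 0 < 1 - 1 / (q : ℝ) := by
            have : 1 / (q : ℝ) ≤ 1 / 2 := by
              rw [div_le_div_iff₀ (by linarith) (by norm_num)]; linarith
            linarith
          have hden : ‖(1 : ℂ) - (q : ℂ)⁻¹‖ = 1 - 1 / (q : ℝ) := by
            have : (1 : ℂ) - (q : ℂ)⁻¹ = ((1 - 1 / (q : ℝ) : ℝ) : ℂ) := by push_cast; ring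
            rw [this, Complex.norm_real, Real.norm_of_nonneg hpos.le]
          have hnum : ‖(1 : ℂ) - (q : ℂ)⁻¹ - χ (q : ZMod D) * (q : ℂ)⁻¹‖ ≤ 1 := by
            have h1 : ‖χ (q : ZMod D) * (q : ℂ)⁻¹‖ ≤ 1 / (q : ℝ) := by
              rw [norm_mul, norm_inv, Complex.norm_natCast, one_div]
              exact mul_le_of_le_one_left (by positivity) (DirichletCharacter.norm_le_one χ _)
            calc ‖(1 : ℂ) - (q : ℂ)⁻¹ - χ (q : ZMod D) * (q : ℂ)⁻¹‖
                ≤ ‖(1 : ℂ) - (q : ℂ)⁻¹‖ + ‖χ (q : ZMod D) * (q : ℂ)⁻¹‖ := norm_sub_le _ _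
              _ ≤ (1 - 1 / (q : ℝ)) + 1 / (q : ℝ) := by rw [hden]; linarith
              _ = 1 := by ring
          rw [norm_div, hden, div_eq_mul_inv]
          calc ‖(1 : ℂ) - (q : ℂ)⁻¹ - χ (q : ZMod D) * (q : ℂ)⁻¹‖ * (1 - 1 / (q : ℝ))⁻¹
              ≤ 1 * (1 - 1 / (q : ℝ))⁻¹ :=
                mul_le_mul_of_nonneg_right hnum (inv_nonneg.mpr hpos.le)
            _ = (1 - 1 / (q : ℝ))⁻¹ := one_mul _
      _ ≤ E := by
          rw [hE]
          apply prod_inv_one_sub_mono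
          · intro q hq
            exact Nat.primeFactors_mono (Dvd.intro r rfl) hn0 (Finset.mem_filter.mp hq).1
          · intro q hq
            exact (Nat.prime_of_mem_primeFactors hq).two_le

/-! ## The aggregated weight over the factorisations of `n` -/

/-- `(n/φ(n))² ≤ ∏_{q∣n}(1 + 6/q)` (`(q/(q−1))² ≤ 1 + 6/q` for `q ≥ 2`). [folklore] -/
private theorem sq_div_totient_le (n : ℕ) (hn : n ≠ 0) :
    ((n : ℝ) / Nat.totient n) ^ 2 ≤ ∏ q ∈ n.primeFactors, (1 + 6 / (q : ℝ)) := by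
  have hnR : (0 : ℝ) < n := by exact_mod_cast Nat.pos_of_ne_zero hn
  have hEq : (n : ℝ) / Nat.totient n = ∏ q ∈ n.primeFactors, (1 - 1 / (q : ℝ))⁻¹ := by
    rw [totient_eq_mul_prod_real n, Finset.prod_inv_distrib]
    field_simp
  rw [hEq, ← Finset.prod_pow]
  apply Finset.prod_le_prod
  · intro q _; positivity
  · intro q hq
    have hq2 : (2 : ℝ) ≤ q := by exact_mod_cast (Nat.prime_of_mem_primeFactors hq).two_le
    have hqpos : (0 : ℝ) < q := by linarith
    have hpos : 0 < 1 - 1 / (q : ℝ) := by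
      have : 1 / (q : ℝ) ≤ 1 / 2 := by rw [div_le_div_iff₀ (by linarith) (by norm_num)]; linarith
      linarith
    rw [inv_pow, inv_le_comm₀ (pow_pos hpos 2) (by positivity)]
    -- `1/(1+6/q) ≤ (1-1/q)²` ⟺ `q³ ≤ (q−1)²(q+6)`, i.e. `0 ≤ 4q² − 11q + 6 = (q−2)(4q−3)`
    rw [show 1 + 6 / (q : ℝ) = (q + 6) / q by field_simp, show 1 - 1 / (q : ℝ) = (q - 1) / q by field_simp,
      inv_div, div_pow, div_le_div_iff₀ (by linarith) (by positivity)]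
    nlinarith [mul_nonneg (by linarith : (0 : ℝ) ≤ q - 2) (by linarith : (0 : ℝ) ≤ 4 * q - 3)]

/-- **The weight of `S_j(𝐚₁₁,𝐚₂₁)` aggregated over `n = dr`** (p. 47): for `n ≥ 1`,
`Σ_{(d,r): dr=n} |μ(r)|·‖λ₀ⱼ(n)‖·(1 + ‖Π(d,r)‖)/(nφ(r)) ≤ 2n⁻¹∏_{q∣n}(1 + 106/q)`
(`‖λ₀ⱼ(n)‖ ≤ (φ(n)/n)∏(1+25/q)` by the tree's `Sec18SjNorm.norm_lamZero_le`, `1 + ‖Π‖ ≤ 2(n/φ(n))²`,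
`Σ_{r∣n sqfree}1/φ(r) = n/φ(n)`, `(n/φ(n))² ≤ ∏(1+6/q)`, `(1+25/q)(1+6/q) ≤ 1+106/q`).
[cite: Zhang2022LandauSiegel, §8 display before (8.10) p.47, tex L2437] -/
theorem weight_antidiagonal_le (c' : ℝ) {D : ℕ} [NeZero D] (χ : DirichletCharacter ℂ D) (j : ℕ)
    {n : ℕ} (hn : n ≠ 0) :
    ∑ p ∈ Nat.divisorsAntidiagonal n,
        ((ArithmeticFunction.moebius p.2).natAbs : ℝ) * ‖lamZero c' D j n‖ *
          (1 + ‖PiW χ p.1 p.2‖) / ((n : ℝ) * Nat.totient p.2) ≤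
      2 * (∏ q ∈ n.primeFactors, (1 + 106 / (q : ℝ))) / n := by
  have hnR : (0 : ℝ) < n := by exact_mod_cast Nat.pos_of_ne_zero hn
  have hφpos : (0 : ℝ) < Nat.totient n := by exact_mod_cast Nat.totient_pos.mpr (Nat.pos_of_ne_zero hn)
  set Q : ℝ := (n : ℝ) / Nat.totient n with hQ
  have hQ1 : 1 ≤ Q := by
    rw [hQ, le_div_iff₀ hφpos, one_mul]; exact_mod_cast Nat.totient_le n
  -- Step 1: bound each term by `‖λ₀ⱼ(n)‖ · 2Q² / n · |μ(r)|/φ(r)`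
  have hterm : ∀ p ∈ Nat.divisorsAntidiagonal n,
      ((ArithmeticFunction.moebius p.2).natAbs : ℝ) * ‖lamZero c' D j n‖ *
          (1 + ‖PiW χ p.1 p.2‖) / ((n : ℝ) * Nat.totient p.2) ≤
        (‖lamZero c' D j n‖ * (2 * Q ^ 2) / n) *
          (((ArithmeticFunction.moebius p.2).natAbs : ℝ) / Nat.totient p.2) := by
    intro p hp
    rw [Nat.mem_divisorsAntidiagonal] at hp
    have hp1 : 1 ≤ p.1 := Nat.one_le_iff_ne_zero.mpr fun h => hp.2 (by rw [← hp.1, h, zero_mul])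
    have hp2 : 1 ≤ p.2 := Nat.one_le_iff_ne_zero.mpr fun h => hp.2 (by rw [← hp.1, h, mul_zero])
    have hφ2 : (0 : ℝ) < Nat.totient p.2 := by exact_mod_cast Nat.totient_pos.mpr hp2
    have hPi : ‖PiW χ p.1 p.2‖ ≤ Q ^ 2 := by
      have := norm_PiW_le χ hp1 hp2
      rwa [hp.1] at this
    have h1 : 1 + ‖PiW χ p.1 p.2‖ ≤ 2 * Q ^ 2 := by nlinarith
    have hμ : (0 : ℝ) ≤ (ArithmeticFunction.moebius p.2).natAbs := by positivity
    rw [div_le_iff₀ (mul_pos hnR hφ2)]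
    calc ((ArithmeticFunction.moebius p.2).natAbs : ℝ) * ‖lamZero c' D j n‖ * (1 + ‖PiW χ p.1 p.2‖)
        ≤ ((ArithmeticFunction.moebius p.2).natAbs : ℝ) * ‖lamZero c' D j n‖ * (2 * Q ^ 2) :=
          mul_le_mul_of_nonneg_left h1 (by positivity)
      _ = ‖lamZero c' D j n‖ * (2 * Q ^ 2) / n *
            (((ArithmeticFunction.moebius p.2).natAbs : ℝ) / Nat.totient p.2) *
            ((n : ℝ) * Nat.totient p.2) := by field_simp
  -- Step 2: `Σ_{dr=n} |μ(r)|/φ(r) = Σ_{r∣n sqfree} 1/φ(r) = n/φ(n)`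
  have hsumμ : ∑ p ∈ Nat.divisorsAntidiagonal n,
      ((ArithmeticFunction.moebius p.2).natAbs : ℝ) / Nat.totient p.2 = Q := by
    rw [Nat.sum_divisorsAntidiagonal' (fun _ b => ((ArithmeticFunction.moebius b).natAbs : ℝ) /
      Nat.totient b), hQ, ← sum_sqfree_inv_totient hn, Finset.sum_filter]
    apply Finset.sum_congr rfl
    intro r _
    by_cases hsq : Squarefree r
    · rw [if_pos hsq]
      have : (ArithmeticFunction.moebius r).natAbs = 1 := by
        rw [← Int.natAbs_abs, ArithmeticFunction.abs_moebius_eq_one_of_squarefree hsq]; rfl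
      rw [this]; push_cast; rfl
    · rw [if_neg hsq, ArithmeticFunction.moebius_eq_zero_of_not_squarefree hsq]; simp
  -- Step 3: assemble
  calc ∑ p ∈ Nat.divisorsAntidiagonal n,
        ((ArithmeticFunction.moebius p.2).natAbs : ℝ) * ‖lamZero c' D j n‖ *
          (1 + ‖PiW χ p.1 p.2‖) / ((n : ℝ) * Nat.totient p.2)
      ≤ ∑ p ∈ Nat.divisorsAntidiagonal n, (‖lamZero c' D j n‖ * (2 * Q ^ 2) / n) *
          (((ArithmeticFunction.moebius p.2).natAbs : ℝ) / Nat.totient p.2) := Finset.sum_le_sum hterm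
    _ = ‖lamZero c' D j n‖ * (2 * Q ^ 2) / n * Q := by rw [← Finset.mul_sum, hsumμ]
    _ ≤ ((∏ q ∈ n.primeFactors, (1 + 25 / (q : ℝ))) * Q⁻¹) * (2 * Q ^ 2) / n * Q := by
        have hlam : ‖lamZero c' D j n‖ ≤ (∏ q ∈ n.primeFactors, (1 + 25 / (q : ℝ))) * Q⁻¹ := by
          have := Sec18SjNorm.norm_lamZero_le c' D j hn
          rwa [hQ, inv_div]
        gcongr
    _ = 2 * ((∏ q ∈ n.primeFactors, (1 + 25 / (q : ℝ))) * Q ^ 2) / n := by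
        field_simp
    _ ≤ 2 * (∏ q ∈ n.primeFactors, (1 + 106 / (q : ℝ))) / n := by
        apply div_le_div_of_nonneg_right _ hnR.le
        apply mul_le_mul_of_nonneg_left _ (by norm_num)
        calc (∏ q ∈ n.primeFactors, (1 + 25 / (q : ℝ))) * Q ^ 2
            ≤ (∏ q ∈ n.primeFactors, (1 + 25 / (q : ℝ))) * ∏ q ∈ n.primeFactors, (1 + 6 / (q : ℝ)) :=
              mul_le_mul_of_nonneg_left (sq_div_totient_le n hn)
                (Finset.prod_nonneg fun q _ => by positivity)
          _ = ∏ q ∈ n.primeFactors, ((1 + 25 / (q : ℝ)) * (1 + 6 / (q : ℝ))) := by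
              rw [Finset.prod_mul_distrib]
          _ ≤ ∏ q ∈ n.primeFactors, (1 + 106 / (q : ℝ)) := by
              apply Finset.prod_le_prod (fun q _ => by positivity)
              intro q hq
              have hq2 : (2 : ℝ) ≤ q := by exact_mod_cast (Nat.prime_of_mem_primeFactors hq).two_le
              have hqpos : (0 : ℝ) < q := by linarith
              rw [show (1 + 25 / (q : ℝ)) * (1 + 6 / q) = 1 + 31 / q + 150 / q ^ 2 by field_simp; ring]
              have : 150 / (q : ℝ) ^ 2 ≤ 75 / q := by
                rw [div_le_div_iff₀ (by positivity) hqpos]; nlinarith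
              have : 31 / (q : ℝ) + 75 / q = 106 / q := by ring
              linarith

end Literature.NumberTheory.LFunctions.Zhang2022.Section8FrontEnd44Weights
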